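import Summits.NavierStokesRegularity.FunctionalMining.TopEigStrainMixRateBound
import HarnessLib

/-!
# FunctionalMining/NoGo — D-K6 (a), COROLLARY K typed: a family of data with mixture heat price
# `H_ε ≤ h(ε)` at a production floor bounds the constant `κ(ε)` of ANY family of saturating laws for
# `F_ε = Φ_q + ε Z_q` from below by `c^{1+γ} / (2B · (2h(ε))^γ)` — general profile `h`, the
# LOGARITHMIC instance `h(ε) = D (ln 1/ε)^{−b}`, and the divergence `κ(ε) → ∞` whenever `h(ε) → 0`

Search for candidate a priori estimates; no regularity claim. Cell `pub-nsfunc`, no-go seat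
(gen 33), STAGED for the prove seat (the planner seat cannot file under `FunctionalMining/`;
`pub-nsfunc-nogo/NoGo/STAGING.md`). Imports only the TREE file `TopEigStrainMixRateBound.lean`
(census-2 seat gen 41, filed by the prove seat: `mixSelProduction` `P_ε`, `mixHeat` `H_ε`, the static-ratio
bound `SaturatingLawSup.mix_static_ratio_le` (L8a) and the power-law dictionary consequence
`TopEigStrainMixRate.gamma_mul_le` (L8b)) and `HarnessLib`.

WHY. (L8b) types the mechanism by which a POWER `a ≥ γ s` on the K1-Q6 (a) rate exponent would be
certified: a family with `0 < H_ε ≤ D ε^s`. Along the only family of record — W18, the mollified healed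
chevron — the mixture heat price decays LOGARITHMICALLY, not as a power: the no-go seat's pen THEOREM R
(`pub-nsfunc-nogo/sieveld/x2c/K1Q6-RATE-NOTE.md` §4, one-party nogo as to the constants; the exponent
`s_W18 = 0` and the shape 'floor ∝ 1/ln(1/ε), no power' AGREED BY VALUE with census-2's sealed-blind
THEOREM L) gives `c_R / ln(1/ε) ≤ inf_{W18} H_ε ≤ C_R′ (ln(1/ε))^{−2/3}`, the ceiling modulo the threshold
clause (TC). Fed into (L8b) this returns only `γ·0 ≤ a`; its informative content — COROLLARY K:
`κ(ε) → ∞` for EVERY family of Sup-laws of `F_ε` at the K0 exponents (unconditional), and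
`κ(ε) ≥ c_κ (ln(1/ε))^{2γ/3}` under (TC) — had no kernel home (remark N-3 of the note: "a faithful Lean
home would be (13) instantiated along a family with `mixHeat q ε w ≤ D * (Real.log ε⁻¹) ^ (-b)`,
concluding that `κ(ε) · (Real.log ε⁻¹)^{−bγ}` is bounded below"). THIS FILE is that home, for an
ARBITRARY heat-price profile `h`.

CONTENT (`T³ = UnitAddTorus (Fin 3)`, real `q ≥ 2`, `σ = 2q − 3`, `γ = (3q − 3)/(2q − 3)`; bookkeeping
only). §1 `MixHeatFamily q c B h ε₁` NAMES the family hypothesis of (L8b) with the power `D ε^s`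
replaced by a profile `h ε` — for every `ε ∈ (0, ε₁]` an admissible datum `w` (smooth, divergence-free,
zero-mean) with a heat-maximal selection `e` (integrable production density), `c ≤ P_ε(w; e)`,
`(2ℰ w) F_ε(w)^{1+1/σ} ≤ B`, `0 < H_ε(w) ≤ h ε`; `TopEigStrainMixRate.gamma_mul_le_of_mixHeatFamily`
re-derives (L8b) from it VERBATIM (the binder is (L8b)'s, by `exact`). §2 ONE DATUM
(`SaturatingLawSup.floor_rpow_le_mixConst`): a Sup-law for `F_ε` with constant `κ` at the exponents
`(2q − 3, γ)`, `γ ≥ 0`, and one such datum with `H_ε ≤ η` give `c (c/(2η))^γ ≤ 2κB` and `0 < κ`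
((L8a) with `P ≥ c`, `H ≤ η`, monotonicity of `x ↦ x^γ`). §3 A FAMILY OF LAWS against a family of data
(`le_mixConst_of_mixHeatFamily`, `mixConst_ge_of_mixHeatFamily`): if `κ : ℝ → ℝ` is ANY function with
`SaturatingLawSup F_ε (2q−3) γ (κ ε)` for `ε ∈ (0, ε₀]` and `MixHeatFamily q c B h ε₁` holds, then for
`ε ∈ (0, min ε₀ ε₁]`: `0 < κ ε`, `0 < B` and **`c^{1+γ} / (2B (2 h ε)^γ) ≤ κ ε`**. §4 THE LOGARITHMIC
INSTANCE (`mixConst_ge_log_of_mixHeatFamily`): with `h ε = D (ln ε⁻¹)^{−b}` (`D > 0`, any real `b`) and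
`ε < 1`: **`(c^{1+γ} / (2B (2D)^γ)) · (ln ε⁻¹)^{bγ} ≤ κ ε`** — COROLLARY K (ii)'s shape (W18 under (TC):
`b = 2/3`, `bγ = (2q − 2)/(2q − 3)`). §5 DIVERGENCE (`tendsto_mixConst_atTop_of_mixHeatFamily`): if
`h ε → 0` as `ε → 0⁺` then **`κ ε → +∞` as `ε → 0⁺`** — COROLLARY K (i)'s shape ('NECESSARILY
`κ(ε′) → ∞`', NOGO.md §3 D-K6 (a)). §6 THE BARRIER READ THE OTHER WAY
(`mixHeat_profile_floor_of_uniform_law`): ONE constant `κ` for all `ε ∈ (0, ε₀]` forces every producing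
bounded-budget family to pay **`h ε ≥ (1/2)(c^{1+γ}/(2Bκ))^{1/γ}`** — a uniform saturating law for the
mixture and a family with vanishing mixture heat price exclude each other, quantitatively; §7 its
logarithmic instance (`exp_neg_le_of_uniform_law_of_log_profile`): with `h ε = D (ln ε⁻¹)^{−b}`, `b > 0`,
the common window of a uniform law and the family satisfies **`ε ≥ exp(−(D/F)^{1/b})`**,
`F = (1/2)(c^{1+γ}/(2Bκ))^{1/γ}` — COROLLARY K (ii) as a bound on the law's window.

NOT CLAIMED. NO family is exhibited and no datum is constructed: the W18 facts (production floor
`c_P/2`, budget `B`, `H_ε → 0` along the diagonal of record, the `(ln 1/ε)^{−2/3}` ceiling under (TC))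
are PEN statements of the no-go seat's notes and enter here only as the HYPOTHESIS `MixHeatFamily`;
no value of the rate exponent `a`, no law for `F_ε` (OPEN; (W-1): the proposer owes `C^stat < ∞`), no row,
no verdict, no dictionary number; nothing about Navier–Stokes regularity or blow-up — every statement
is an implication between candidate a priori inequalities read at `t = 0` along short-time classical
solutions from smooth data. RELATION: the CONDITIONAL cap side for the POWER profile (`a ≤ 1`, `a ≤ γ`
⇒ `s ≤ 1/γ`, `s ≤ 1`) is the dict seat's staged conjecture-node file (`TopEigStrainMixRateOne`,
`TopEigStrainMixRateGamma`; conjectures, never facts); this file is UNCONDITIONAL and profile-general and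
shares with it only the tree import. [ours, bookkeeping; D-K6 (a) COROLLARY K (i)/(ii) typed, K1-Q6 (a)]
FILING (prove seat g25, REQUEST #14): declarations byte-identical to the no-go seat's staged `TopEigStrainMixLogRate.STAGING.lean` dcd2e3a72f26994d; this line is the only addition.
-/

noncomputable section

open MeasureTheory Set Filter Topology

namespace Summit.NavierStokesRegularity.FunctionalMining

open Literature.Analysis.FunctionSpaces Literature.Analysis.FluidPDE TopEig

/-! ## 1. The family hypothesis of (L8b), with a general heat-price profile -/

/-- **`MixHeatFamily q c B h ε₁`** — the family hypothesis of `TopEigStrainMixRate.gamma_mul_le` with the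
power `D ε^s` replaced by an arbitrary profile `h ε`: for every `ε ∈ (0, ε₁]` there is a smooth
divergence-free zero-mean datum `w` on `T³` with a heat-maximal selection `e` whose production density is
integrable, production floor `c ≤ P_ε(w; e)`, budget `(2ℰ w) F_ε(w)^{1+1/(2q−3)} ≤ B` and mixture heat
price `0 < H_ε(w) ≤ h ε`. A HYPOTHESIS — search for candidate a priori estimates; no regularity claim;
nothing is asserted by the definition and no such family is exhibited in the kernel. [ours, bookkeeping] -/
def MixHeatFamily (q c B : ℝ) (h : ℝ → ℝ) (ε₁ : ℝ) : Prop :=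
  ∀ ε : ℝ, 0 < ε → ε ≤ ε₁ →
    ∃ w : UnitAddTorus (Fin 3) → EuclideanSpace ℝ (Fin 3),
      Torus.IsSmooth w ∧ Torus.IsDivFree w ∧ Torus.HasZeroMean w ∧
      ∃ e : UnitAddTorus (Fin 3) → Fin 3 → ℝ, IsHeatMaxSelection w e ∧
        Integrable (fun x => q * torusStrainTopEig w x ^ (q - 1) *
          quad (eulerStrainVec w x) (e x)) volume ∧
        c ≤ mixSelProduction q ε w e ∧
        2 * torusEnstrophy w * topEigStrainMix q ε w ^ (1 + (2 * q - 3)⁻¹) ≤ B ∧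
        0 < mixHeat q ε w ∧ mixHeat q ε w ≤ h ε

/-- A family is monotone in the profile: `h ≤ h'` on `(0, ε₁]` transports `MixHeatFamily q c B h ε₁` to
`h'`. [ours, bookkeeping] -/
theorem MixHeatFamily.mono {q c B ε₁ : ℝ} {h h' : ℝ → ℝ} (hf : MixHeatFamily q c B h ε₁)
    (hle : ∀ ε : ℝ, 0 < ε → ε ≤ ε₁ → h ε ≤ h' ε) : MixHeatFamily q c B h' ε₁ := by
  intro ε hε hε₁
  obtain ⟨w, hw, hdw, hmean, e, he, hint, hcP, hbB, hH, hHh⟩ := hf ε hε hε₁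
  exact ⟨w, hw, hdw, hmean, e, he, hint, hcP, hbB, hH, hHh.trans (hle ε hε hε₁)⟩

/-- A family on `(0, ε₁]` restricts to `(0, ε₁']` for `ε₁' ≤ ε₁`. [ours, bookkeeping] -/
theorem MixHeatFamily.restrict {q c B ε₁ ε₁' : ℝ} {h : ℝ → ℝ} (hf : MixHeatFamily q c B h ε₁)
    (hle : ε₁' ≤ ε₁) : MixHeatFamily q c B h ε₁' :=
  fun ε hε hε₁ => hf ε hε (hε₁.trans hle)

/-- (L8b) re-derived VERBATIM from the named hypothesis: a family with `H_ε ≤ D ε^s` at a production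
floor forces `γ s ≤ a` under `TopEigStrainMixRate q a` — the binder of `MixHeatFamily` IS (L8b)'s.
[ours, bookkeeping; tree `TopEigStrainMixRate.gamma_mul_le`] -/
theorem TopEigStrainMixRate.gamma_mul_le_of_mixHeatFamily {q a s c B D ε₁ : ℝ} (hq : 2 ≤ q)
    (h : TopEigStrainMixRate (d := Fin 3) q a) (hc : 0 < c) (hD : 0 < D) (hε₁ : 0 < ε₁)
    (hfam : MixHeatFamily q c B (fun ε => D * ε ^ s) ε₁) :
    (3 * q - 3) / (2 * q - 3) * s ≤ a :=
  TopEigStrainMixRate.gamma_mul_le hq h hc hD hε₁ hfam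

/-! ## 2. One datum: `c (c/(2η))^γ ≤ 2 κ B` -/

/-- **ONE DATUM bounds the mixture constant.** Under `SaturatingLawSup F_ε (2q−3) γ κ` on `T³`
(`q ≥ 2`, `γ ≥ 0`, `ε ≥ 0`): an admissible datum `w` with a heat-maximal selection `e` (integrable
production density), `c ≤ P_ε(w; e)` with `c > 0`, budget `(2ℰ w) F_ε(w)^{1+1/(2q−3)} ≤ B` and
`0 < H_ε(w) ≤ η` gives `c (c/(2η))^γ ≤ 2κB`, and `κ > 0`. [(L8a) `SaturatingLawSup.mix_static_ratio_le`
with `P ≥ c`, `H ≤ η` and the monotonicity of `x ↦ x^γ`; ours, bookkeeping] -/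
theorem SaturatingLawSup.floor_rpow_le_mixConst {q ε γ κ c B η : ℝ} (hq : 2 ≤ q)
    (hlaw : SaturatingLawSup (d := Fin 3) (topEigStrainMix q ε) (2 * q - 3) γ κ) (hγ : 0 ≤ γ)
    (hc : 0 < c) (hε : 0 ≤ ε)
    {w : UnitAddTorus (Fin 3) → EuclideanSpace ℝ (Fin 3)} (hw : Torus.IsSmooth w)
    (hdw : Torus.IsDivFree w) (hmean : Torus.HasZeroMean w) {e : UnitAddTorus (Fin 3) → Fin 3 → ℝ}
    (he : IsHeatMaxSelection w e)
    (hint : Integrable (fun x => q * torusStrainTopEig w x ^ (q - 1) *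
      quad (eulerStrainVec w x) (e x)) volume)
    (hcP : c ≤ mixSelProduction q ε w e)
    (hbB : 2 * torusEnstrophy w * topEigStrainMix q ε w ^ (1 + (2 * q - 3)⁻¹) ≤ B)
    (hH : 0 < mixHeat q ε w) (hHη : mixHeat q ε w ≤ η) :
    c * (c / (2 * η)) ^ γ ≤ 2 * κ * B ∧ 0 < κ := by
  have hP : 0 < mixSelProduction q ε w e := hc.trans_le hcP
  have hmem := hlaw.mix_static_ratio_le hq (by simp) hw hdw hmean he hint hP hH
  set P := mixSelProduction q ε w e with hPdef
  set H := mixHeat q ε w with hHdef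
  set b := 2 * torusEnstrophy w * topEigStrainMix q ε w ^ (1 + (2 * q - 3)⁻¹) with hbdef
  have hη : 0 < η := hH.trans_le hHη
  -- `c/(2η) ≤ P/(2H)`
  have hratio : c / (2 * η) ≤ P / (2 * H) := by
    rw [div_le_div_iff₀ (by positivity) (by positivity)]
    calc c * (2 * H) ≤ P * (2 * H) := by gcongr
      _ ≤ P * (2 * η) := by gcongr
  have hcr : 0 < c / (2 * η) := by positivity
  have hlow : c * (c / (2 * η)) ^ γ ≤ P * (P / (2 * H)) ^ γ :=
    mul_le_mul hcP (Real.rpow_le_rpow hcr.le hratio hγ) (Real.rpow_nonneg hcr.le _) hP.le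
  have hLpos : 0 < c * (c / (2 * η)) ^ γ := mul_pos hc (Real.rpow_pos_of_pos hcr _)
  -- `κ > 0`: the left side is positive and the budget is non-negative
  have hb0 : 0 ≤ b := mul_nonneg (mul_nonneg two_pos.le (torusEnstrophy_nonneg w))
    (Real.rpow_nonneg (topEigStrainMix_nonneg hε w) _)
  have hκb : 0 < 2 * κ * b := hLpos.trans_le (hlow.trans hmem)
  have hκ : 0 < κ := by
    by_contra hk
    push Not at hk
    nlinarith [mul_nonneg (neg_nonneg.2 hk) hb0]
  refine ⟨hlow.trans (hmem.trans ?_), hκ⟩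
  exact mul_le_mul_of_nonneg_left hbB (by positivity)

/-! ## 3. A family of laws against a family of data -/

/-- **A family of Sup-laws for `F_ε` against a `MixHeatFamily`.** If `κ : ℝ → ℝ` is ANY function with
`SaturatingLawSup F_ε (2q−3) γ (κ ε)` for all `ε ∈ (0, ε₀]` (`γ = (3q−3)/(2q−3)`, `q ≥ 2`) and
`MixHeatFamily q c B h ε₁` holds with `c > 0`, then for every `ε ∈ (0, ε₀] ∩ (0, ε₁]`:
`c (c/(2 h ε))^γ ≤ 2 κ(ε) B` and `0 < κ ε`. [ours, bookkeeping] -/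
theorem le_mixConst_of_mixHeatFamily {q c B ε₀ ε₁ : ℝ} {κ h : ℝ → ℝ} (hq : 2 ≤ q)
    (hlaw : ∀ ε : ℝ, 0 < ε → ε ≤ ε₀ →
      SaturatingLawSup (d := Fin 3) (topEigStrainMix q ε) (2 * q - 3) ((3 * q - 3) / (2 * q - 3)) (κ ε))
    (hc : 0 < c) (hfam : MixHeatFamily q c B h ε₁) {ε : ℝ} (hε : 0 < ε) (hε₀ : ε ≤ ε₀)
    (hε₁ : ε ≤ ε₁) :
    c * (c / (2 * h ε)) ^ ((3 * q - 3) / (2 * q - 3)) ≤ 2 * κ ε * B ∧ 0 < κ ε := by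
  obtain ⟨w, hw, hdw, hmean, e, he, hint, hcP, hbB, hH, hHh⟩ := hfam ε hε hε₁
  have hγ : 0 ≤ (3 * q - 3) / (2 * q - 3) := div_nonneg (by linarith) (by linarith)
  exact (hlaw ε hε hε₀).floor_rpow_le_mixConst hq hγ hc hε.le hw hdw hmean he hint hcP hbB hH hHh

/-- Under the hypotheses of `le_mixConst_of_mixHeatFamily` the budget bound is positive: `0 < B`
(some `ε ∈ (0, min ε₀ ε₁]` exists). [ours, bookkeeping] -/
theorem budget_pos_of_mixHeatFamily {q c B ε₀ ε₁ : ℝ} {κ h : ℝ → ℝ} (hq : 2 ≤ q)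
    (hlaw : ∀ ε : ℝ, 0 < ε → ε ≤ ε₀ →
      SaturatingLawSup (d := Fin 3) (topEigStrainMix q ε) (2 * q - 3) ((3 * q - 3) / (2 * q - 3)) (κ ε))
    (hc : 0 < c) (hε₀ : 0 < ε₀) (hε₁ : 0 < ε₁) (hfam : MixHeatFamily q c B h ε₁) : 0 < B := by
  set ε := min ε₀ ε₁ with hεdef
  have hε : 0 < ε := lt_min hε₀ hε₁
  obtain ⟨hle, hκ⟩ := le_mixConst_of_mixHeatFamily hq hlaw hc hfam hε (min_le_left _ _)
    (min_le_right _ _)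
  obtain ⟨w, -, -, -, e, -, -, -, -, hH, hHh⟩ := hfam ε hε (min_le_right _ _)
  have hh : 0 < h ε := hH.trans_le hHh
  have hL : 0 < c * (c / (2 * h ε)) ^ ((3 * q - 3) / (2 * q - 3)) :=
    mul_pos hc (Real.rpow_pos_of_pos (by positivity) _)
  have h2κB : 0 < 2 * κ ε * B := hL.trans_le hle
  exact (mul_pos_iff_of_pos_left (by positivity)).1 h2κB

/-- **The explicit lower bound on the mixture constant.** Under the hypotheses of
`le_mixConst_of_mixHeatFamily`, for every `ε ∈ (0, ε₀] ∩ (0, ε₁]`: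
`c^{1+γ} / (2B · (2 h ε)^γ) ≤ κ ε`, `γ = (3q−3)/(2q−3)`. [ours, bookkeeping] -/
theorem mixConst_ge_of_mixHeatFamily {q c B ε₀ ε₁ : ℝ} {κ h : ℝ → ℝ} (hq : 2 ≤ q)
    (hlaw : ∀ ε : ℝ, 0 < ε → ε ≤ ε₀ →
      SaturatingLawSup (d := Fin 3) (topEigStrainMix q ε) (2 * q - 3) ((3 * q - 3) / (2 * q - 3)) (κ ε))
    (hc : 0 < c) (hε₀ : 0 < ε₀) (hε₁ : 0 < ε₁) (hfam : MixHeatFamily q c B h ε₁) {ε : ℝ}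
    (hε : 0 < ε) (hle₀ : ε ≤ ε₀) (hle₁ : ε ≤ ε₁) :
    c ^ (1 + (3 * q - 3) / (2 * q - 3)) /
        (2 * B * (2 * h ε) ^ ((3 * q - 3) / (2 * q - 3))) ≤ κ ε := by
  set γ := (3 * q - 3) / (2 * q - 3) with hγdef
  have hB : 0 < B := budget_pos_of_mixHeatFamily hq hlaw hc hε₀ hε₁ hfam
  obtain ⟨hbd, hκ⟩ := le_mixConst_of_mixHeatFamily hq hlaw hc hfam hε hle₀ hle₁
  obtain ⟨w, -, -, -, e, -, -, -, -, hH, hHh⟩ := hfam ε hε hle₁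
  have hh : 0 < h ε := hH.trans_le hHh
  have h2h : 0 < (2 * h ε) ^ γ := Real.rpow_pos_of_pos (by positivity) _
  -- `c (c/(2hε))^γ = c^{1+γ} / (2hε)^γ`
  have hsplit : c * (c / (2 * h ε)) ^ γ = c ^ (1 + γ) / (2 * h ε) ^ γ := by
    rw [Real.div_rpow hc.le (by positivity), Real.rpow_add hc, Real.rpow_one]
    ring
  rw [hsplit] at hbd
  rw [div_le_iff₀ (by positivity)]
  calc c ^ (1 + γ) = c ^ (1 + γ) / (2 * h ε) ^ γ * (2 * h ε) ^ γ := by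
        field_simp
    _ ≤ 2 * κ ε * B * (2 * h ε) ^ γ := mul_le_mul_of_nonneg_right hbd h2h.le
    _ = κ ε * (2 * B * (2 * h ε) ^ γ) := by ring

/-! ## 4. The logarithmic instance (COROLLARY K (ii)'s shape) -/

/-- **LOGARITHMIC LAW ⇒ LOGARITHMIC DIVERGENCE OF `κ(ε)`.** If `κ : ℝ → ℝ` carries Sup-laws for `F_ε`
at the exponents `(2q−3, γ)` on `(0, ε₀]` and a `MixHeatFamily q c B h ε₁` has the logarithmic profile
`h ε = D (ln ε⁻¹)^{−b}` (`D > 0`, `c > 0`, any real `b`), then for every `ε ∈ (0, ε₀] ∩ (0, ε₁]` with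
`ε < 1`: `(c^{1+γ} / (2B (2D)^γ)) · (ln ε⁻¹)^{bγ} ≤ κ ε`. Along W18 the pen ceiling of THEOREM R (ii)
(conditional on the threshold clause (TC)) is `b = 2/3`, giving the exponent `2γ/3 = (2q−2)/(2q−3)`
(= 2, 4/3, 6/5 at `q = 2, 3, 4`); that instance is NOT asserted here. [ours, bookkeeping] -/
theorem mixConst_ge_log_of_mixHeatFamily {q c B D b ε₀ ε₁ : ℝ} {κ : ℝ → ℝ} (hq : 2 ≤ q)
    (hlaw : ∀ ε : ℝ, 0 < ε → ε ≤ ε₀ →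
      SaturatingLawSup (d := Fin 3) (topEigStrainMix q ε) (2 * q - 3) ((3 * q - 3) / (2 * q - 3)) (κ ε))
    (hc : 0 < c) (hD : 0 < D) (hε₀ : 0 < ε₀) (hε₁ : 0 < ε₁)
    (hfam : MixHeatFamily q c B (fun ε => D * Real.log ε⁻¹ ^ (-b)) ε₁) {ε : ℝ}
    (hε : 0 < ε) (hle₀ : ε ≤ ε₀) (hle₁ : ε ≤ ε₁) (hε1 : ε < 1) :
    c ^ (1 + (3 * q - 3) / (2 * q - 3)) / (2 * B * (2 * D) ^ ((3 * q - 3) / (2 * q - 3))) *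
        Real.log ε⁻¹ ^ (b * ((3 * q - 3) / (2 * q - 3))) ≤ κ ε := by
  set γ := (3 * q - 3) / (2 * q - 3) with hγdef
  have hB : 0 < B := budget_pos_of_mixHeatFamily hq hlaw hc hε₀ hε₁ hfam
  have hmain := mixConst_ge_of_mixHeatFamily hq hlaw hc hε₀ hε₁ hfam hε hle₀ hle₁
  rw [← hγdef] at hmain
  have hL : 0 < Real.log ε⁻¹ := Real.log_pos ((one_lt_inv₀ hε).2 hε1)
  -- `(2 (D L^{-b}))^γ = (2D)^γ L^{-(bγ)}`
  have hpow : (2 * (D * Real.log ε⁻¹ ^ (-b))) ^ γ = (2 * D) ^ γ * (Real.log ε⁻¹ ^ (b * γ))⁻¹ := by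
    rw [show 2 * (D * Real.log ε⁻¹ ^ (-b)) = (2 * D) * Real.log ε⁻¹ ^ (-b) by ring,
      Real.mul_rpow (by positivity) (Real.rpow_nonneg hL.le _), ← Real.rpow_mul hL.le,
      show -b * γ = -(b * γ) by ring, Real.rpow_neg hL.le]
  rw [hpow] at hmain
  have h2D : 0 < (2 * D) ^ γ := Real.rpow_pos_of_pos (by positivity) _
  have hLγ : 0 < Real.log ε⁻¹ ^ (b * γ) := Real.rpow_pos_of_pos hL _
  have hcγ : 0 < c ^ (1 + γ) := Real.rpow_pos_of_pos hc _
  calc c ^ (1 + γ) / (2 * B * (2 * D) ^ γ) * Real.log ε⁻¹ ^ (b * γ)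
      = c ^ (1 + γ) / (2 * B * ((2 * D) ^ γ * (Real.log ε⁻¹ ^ (b * γ))⁻¹)) := by
        field_simp
    _ ≤ κ ε := hmain

/-! ## 5. Divergence (COROLLARY K (i)'s shape): `h(ε) → 0` forces `κ(ε) → ∞` -/

/-- **`κ(ε) → ∞` NECESSARILY.** If `κ : ℝ → ℝ` carries Sup-laws for `F_ε` at the exponents `(2q−3, γ)`
on `(0, ε₀]` (`q ≥ 2`) and a `MixHeatFamily q c B h ε₁` (`c > 0`) has heat-price profile `h ε → 0` as
`ε → 0⁺`, then `κ ε → +∞` as `ε → 0⁺`. Along W18 the profile `h → 0` is the no-go seat's pen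
statement 'THEOREM R (ii)-unconditional' (`inf_k H_ε(w_k) → 0` along the diagonal of record at floor
`c_P/2` and budget `B`); it is NOT asserted here. [ours, bookkeeping; NOGO.md §3 D-K6 (a) 'NECESSARILY
`κ(ε′) → ∞`'] -/
theorem tendsto_mixConst_atTop_of_mixHeatFamily {q c B ε₀ ε₁ : ℝ} {κ h : ℝ → ℝ} (hq : 2 ≤ q)
    (hlaw : ∀ ε : ℝ, 0 < ε → ε ≤ ε₀ →
      SaturatingLawSup (d := Fin 3) (topEigStrainMix q ε) (2 * q - 3) ((3 * q - 3) / (2 * q - 3)) (κ ε))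
    (hc : 0 < c) (hε₀ : 0 < ε₀) (hε₁ : 0 < ε₁) (hfam : MixHeatFamily q c B h ε₁)
    (hh : Tendsto h (𝓝[>] 0) (𝓝 0)) :
    Tendsto κ (𝓝[>] 0) atTop := by
  set γ := (3 * q - 3) / (2 * q - 3) with hγdef
  have hγ : 0 < γ := div_pos (by linarith) (by linarith)
  have hB : 0 < B := budget_pos_of_mixHeatFamily hq hlaw hc hε₀ hε₁ hfam
  have hcγ : 0 < c ^ (1 + γ) := Real.rpow_pos_of_pos hc _
  set K := c ^ (1 + γ) / (2 * B) with hKdef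
  have hK : 0 < K := by positivity
  -- the window `(0, min ε₀ ε₁)` is a neighbourhood of `0⁺`
  have hwin : ∀ᶠ ε in 𝓝[>] (0 : ℝ), 0 < ε ∧ ε ≤ ε₀ ∧ ε ≤ ε₁ := by
    filter_upwards [Ioo_mem_nhdsGT (lt_min hε₀ hε₁)] with ε hε
    exact ⟨hε.1, (hε.2.le.trans (min_le_left _ _)), (hε.2.le.trans (min_le_right _ _))⟩
  -- `(2 h ε)^γ → 0⁺`
  have hpos : ∀ᶠ ε in 𝓝[>] (0 : ℝ), 0 < (2 * h ε) ^ γ := by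
    filter_upwards [hwin] with ε hε
    obtain ⟨w, -, -, -, e, -, -, -, -, hH, hHh⟩ := hfam ε hε.1 hε.2.2
    exact Real.rpow_pos_of_pos (by linarith [hH.trans_le hHh]) _
  have h2h : Tendsto (fun ε => (2 * h ε) ^ γ) (𝓝[>] 0) (𝓝 0) := by
    have h1 : Tendsto (fun ε => 2 * h ε) (𝓝[>] 0) (𝓝 (2 * 0)) := hh.const_mul 2
    rw [mul_zero] at h1
    have h2 := h1.rpow_const (p := γ) (Or.inr hγ.le)
    rwa [Real.zero_rpow hγ.ne'] at h2
  have h2h' : Tendsto (fun ε => (2 * h ε) ^ γ) (𝓝[>] 0) (𝓝[>] 0) :=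
    tendsto_nhdsWithin_iff.2 ⟨h2h, hpos⟩
  have hinv : Tendsto (fun ε => K * ((2 * h ε) ^ γ)⁻¹) (𝓝[>] 0) atTop :=
    (tendsto_inv_nhdsGT_zero.comp h2h').const_mul_atTop hK
  refine tendsto_atTop_mono' _ ?_ hinv
  filter_upwards [hwin] with ε hε
  have hmain := mixConst_ge_of_mixHeatFamily hq hlaw hc hε₀ hε₁ hfam hε.1 hε.2.1 hε.2.2
  rw [← hγdef] at hmain
  calc K * ((2 * h ε) ^ γ)⁻¹ = c ^ (1 + γ) / (2 * B * (2 * h ε) ^ γ) := by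
        rw [hKdef]; field_simp
    _ ≤ κ ε := hmain

/-! ## 6. The barrier read the other way: a UNIFORM law forces a floor on the heat price -/

/-- **UNIFORM LAW ⇒ HEAT-PRICE FLOOR.** If ONE constant `κ` serves every `ε ∈ (0, ε₀]`
(`SaturatingLawSup F_ε (2q−3) γ κ`), then every family of admissible data with production floor `c > 0`
and budget `B` pays, for `ε ∈ (0, min ε₀ ε₁]`, a mixture heat price
**`(1/2) · (c^{1+γ} / (2Bκ))^{1/γ} ≤ h ε`** — equivalently no `MixHeatFamily q c B h ε₁` with
`h ε → 0` coexists with a uniform law (cf. §5). The typed boundary of escape door D-K6 (a): a uniform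
saturating law for the mixture is refuted by, and only by (within this bookkeeping), producing
bounded-budget families whose mixture heat price tends to zero. [ours, bookkeeping] -/
theorem mixHeat_profile_floor_of_uniform_law {q c B ε₀ ε₁ κ : ℝ} {h : ℝ → ℝ} (hq : 2 ≤ q)
    (hlaw : ∀ ε : ℝ, 0 < ε → ε ≤ ε₀ →
      SaturatingLawSup (d := Fin 3) (topEigStrainMix q ε) (2 * q - 3) ((3 * q - 3) / (2 * q - 3)) κ)
    (hc : 0 < c) (hε₀ : 0 < ε₀) (hε₁ : 0 < ε₁) (hfam : MixHeatFamily q c B h ε₁) {ε : ℝ}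
    (hε : 0 < ε) (hle₀ : ε ≤ ε₀) (hle₁ : ε ≤ ε₁) :
    (1 / 2) * (c ^ (1 + (3 * q - 3) / (2 * q - 3)) / (2 * B * κ)) ^ (((3 * q - 3) / (2 * q - 3))⁻¹) ≤
      h ε := by
  set γ := (3 * q - 3) / (2 * q - 3) with hγdef
  have hγ : 0 < γ := div_pos (by linarith) (by linarith)
  have hB : 0 < B := budget_pos_of_mixHeatFamily (κ := fun _ => κ) hq hlaw hc hε₀ hε₁ hfam
  obtain ⟨-, hκ⟩ := le_mixConst_of_mixHeatFamily (κ := fun _ => κ) hq hlaw hc hfam hε hle₀ hle₁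
  have hmain := mixConst_ge_of_mixHeatFamily (κ := fun _ => κ) hq hlaw hc hε₀ hε₁ hfam hε hle₀ hle₁
  simp only [← hγdef] at hmain hκ
  obtain ⟨w, -, -, -, e, -, -, -, -, hH, hHh⟩ := hfam ε hε hle₁
  have hh : 0 < h ε := hH.trans_le hHh
  have h2h : 0 < (2 * h ε) ^ γ := Real.rpow_pos_of_pos (by positivity) _
  -- `c^{1+γ}/(2Bκ) ≤ (2hε)^γ`
  have hstep : c ^ (1 + γ) / (2 * B * κ) ≤ (2 * h ε) ^ γ := by
    rw [div_le_iff₀ (by positivity)]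
    have := (div_le_iff₀ (show (0 : ℝ) < 2 * B * (2 * h ε) ^ γ by positivity)).1 hmain
    linarith [this]
  -- invert `x ↦ x^γ`
  have hnn : 0 ≤ c ^ (1 + γ) / (2 * B * κ) := by positivity
  have hroot : (c ^ (1 + γ) / (2 * B * κ)) ^ γ⁻¹ ≤ 2 * h ε := by
    calc (c ^ (1 + γ) / (2 * B * κ)) ^ γ⁻¹ ≤ ((2 * h ε) ^ γ) ^ γ⁻¹ :=
          Real.rpow_le_rpow hnn hstep (inv_nonneg.2 hγ.le)
      _ = 2 * h ε := Real.rpow_rpow_inv (by positivity) hγ.ne'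
  linarith [hroot]

/-! ## 7. The logarithmic instance of §6: the window of a uniform law cannot reach below
`exp(−(D/F)^{1/b})` -/

/-- **UNIFORM LAW + LOGARITHMIC HEAT PRICE ⇒ AN EXPLICIT FLOOR ON `ε`.** With the §6 floor
`F := (1/2)(c^{1+γ}/(2Bκ))^{1/γ}` and a family paying `0 < H_ε ≤ D (ln ε⁻¹)^{−b}` (`b > 0`; `D > 0` is
forced), every
`ε < 1` of the common window satisfies **`exp(−(D/F)^{1/b}) ≤ ε`**: a uniform saturating law for the
mixture with constant `κ` on `(0, ε₀]` and such a family on `(0, ε₁]` force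
`min ε₀ ε₁ ≥ exp(−(D/F)^{1/b})` — COROLLARY K (ii) read as a bound on the law's window (W18 under (TC):
`b = 2/3`). [ours, bookkeeping] -/
theorem exp_neg_le_of_uniform_law_of_log_profile {q c B D b ε₀ ε₁ κ : ℝ} (hq : 2 ≤ q)
    (hlaw : ∀ ε : ℝ, 0 < ε → ε ≤ ε₀ →
      SaturatingLawSup (d := Fin 3) (topEigStrainMix q ε) (2 * q - 3) ((3 * q - 3) / (2 * q - 3)) κ)
    (hc : 0 < c) (hε₀ : 0 < ε₀) (hε₁ : 0 < ε₁) (hb : 0 < b)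
    (hfam : MixHeatFamily q c B (fun ε => D * Real.log ε⁻¹ ^ (-b)) ε₁) {ε : ℝ}
    (hε : 0 < ε) (hle₀ : ε ≤ ε₀) (hle₁ : ε ≤ ε₁) (hε1 : ε < 1) :
    Real.exp (-(D / ((1 / 2) * (c ^ (1 + (3 * q - 3) / (2 * q - 3)) / (2 * B * κ)) ^
        (((3 * q - 3) / (2 * q - 3))⁻¹))) ^ b⁻¹) ≤ ε := by
  set γ := (3 * q - 3) / (2 * q - 3) with hγdef
  have hγ : 0 < γ := div_pos (by linarith) (by linarith)
  have hB : 0 < B := budget_pos_of_mixHeatFamily (κ := fun _ => κ) hq hlaw hc hε₀ hε₁ hfam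
  obtain ⟨-, hκ⟩ := le_mixConst_of_mixHeatFamily (κ := fun _ => κ) hq hlaw hc hfam hε hle₀ hle₁
  have hfloor := mixHeat_profile_floor_of_uniform_law hq hlaw hc hε₀ hε₁ hfam hε hle₀ hle₁
  simp only [← hγdef] at hfloor hκ ⊢
  set F := (1 / 2) * (c ^ (1 + γ) / (2 * B * κ)) ^ γ⁻¹ with hFdef
  have hcγ : 0 < c ^ (1 + γ) := Real.rpow_pos_of_pos hc _
  have hF : 0 < F := by
    have : 0 < (c ^ (1 + γ) / (2 * B * κ)) ^ γ⁻¹ := Real.rpow_pos_of_pos (by positivity) _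
    rw [hFdef]; positivity
  -- `L := ln ε⁻¹ > 0`
  have hL : 0 < Real.log ε⁻¹ := Real.log_pos ((one_lt_inv₀ hε).2 hε1)
  have hLb : 0 < Real.log ε⁻¹ ^ b := Real.rpow_pos_of_pos hL _
  -- `F ≤ D L^{-b}` ⇒ `L^b ≤ D / F`
  have h1 : Real.log ε⁻¹ ^ b ≤ D / F := by
    rw [le_div_iff₀ hF]
    have h' : F * Real.log ε⁻¹ ^ b ≤ D * Real.log ε⁻¹ ^ (-b) * Real.log ε⁻¹ ^ b :=
      mul_le_mul_of_nonneg_right hfloor hLb.le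
    have h'' : D * Real.log ε⁻¹ ^ (-b) * Real.log ε⁻¹ ^ b = D := by
      rw [mul_assoc, ← Real.rpow_add hL, neg_add_cancel, Real.rpow_zero, mul_one]
    linarith [h', h'']
  -- ⇒ `L ≤ (D/F)^{1/b}`
  have h2 : Real.log ε⁻¹ ≤ (D / F) ^ b⁻¹ := by
    calc Real.log ε⁻¹ = (Real.log ε⁻¹ ^ b) ^ b⁻¹ := (Real.rpow_rpow_inv hL.le hb.ne').symm
      _ ≤ (D / F) ^ b⁻¹ := Real.rpow_le_rpow hLb.le h1 (inv_nonneg.2 hb.le)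
  -- ⇒ `ε⁻¹ ≤ exp((D/F)^{1/b})` ⇒ `exp(−(D/F)^{1/b}) ≤ ε`
  have h3 : ε⁻¹ ≤ Real.exp ((D / F) ^ b⁻¹) := by
    calc ε⁻¹ = Real.exp (Real.log ε⁻¹) := (Real.exp_log (inv_pos.2 hε)).symm
      _ ≤ Real.exp ((D / F) ^ b⁻¹) := Real.exp_le_exp.2 h2
  rw [Real.exp_neg]
  calc (Real.exp ((D / F) ^ b⁻¹))⁻¹ ≤ (ε⁻¹)⁻¹ := by
        exact inv_anti₀ (inv_pos.2 hε) h3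
    _ = ε := inv_inv ε

end Summit.NavierStokesRegularity.FunctionalMining

end
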